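import Summits.CriticalPhenomena.PercolationContinuityZ3.Theorems.PercNearOneGluingNoHeavyLowerTailKnQuestion8CoefficientwiseCoreClassKernelMixBoundaryPrefixFlows
import HarnessLib

/-!
# Boundary inequality on bundles, VIII: one prefix-frozen fibre system on a general ground set (the MERGED SCHEME, abstract core)

Support file (`--supports stmt-CriticalPhenomena-4575`, closed), prover `prim-cplus-coupling` (gen 57).  No definitions, no notations, no named facts,
no sorries; standard axioms.  Memo `prim-cplus-coupling/A5-COUPLING-gen57.md` §2 (MERGED-SCHEME LEMMA).

ABSTRACT SETTING.  As in `…KernelMixBoundaryPrefixFlows` (`boundary_systems_count`), but for ONE type and on a general ground set: colourings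
`ξ ⊆ E'` where `E' ⊇ P ∪ Q` contains the two prefix-freezable threads `P = {eP 1..eP ℓ}`, `Q = {eQ 1..eQ m}` AND an arbitrary remainder
`E' ∖ (P ∪ Q)` of FREE coordinates (in the application: the other threads of the bundle, no slab, no lift).  Status predicates `Vp, hro`
(increasing), `kbo, N` (decreasing; `N` = the demand region, assumed to exclude colourings in which `P` or `Q` is fully red); SOURCES
`Vp ∧ N ∧ hro ∧ kbo`.  The fibre system is `SP ×ˢ SQ` with `SP ∈ {{0}, [1, ℓ−1]}` (thread `P` free / prefix-frozen), likewise `SQ`; a thread may be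
frozen only if every source starts red on it (`covP`, `covQ`).  In the fibre `(a, c)` the PARTNER `ρ` of `ξ` keeps the frozen prefixes `R^a B`, `R^c B`
and complements every other coordinate of `E'` (the rest of `P`, `Q` and the whole remainder).  TRANSFER hypothesis: a landing `ξ` (with `Vp ξ`, `hro ξ`,
`kbo ρ`, `N ρ`, described edge by edge) satisfies the target predicate `T`.
* `Coefficientwise.fibre_system_count` — `#sources ≤ #{ξ ⊆ E' : T ξ}` (Harris per fibre = `frozen_fibre_flow`; the fibres are disjoint and cover the
  sources; the landing of a fibre point is the point itself, so the landings form a SET and no lift, no join bookkeeping is needed).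
On a bundle (`…KernelMixBundleTwoFreeze`) this is the merged scheme: `#bad₁(𝒱) ≤ #M₁^F(𝒱)` with `M₁^F ⊆ L₁(𝒱)`, and the TWO-FREEZE THEOREM.
[cite: KozmaNitzan2024, Questions 8–9 (§5.5 p. 36) (context); Harris 1960]
-/

namespace Summit.CriticalPhenomena.PercolationContinuityZ3.Theorems

open Finset

namespace Coefficientwise

variable {ι : Type*}

open Classical in
/-- **One prefix-frozen fibre system on a general ground set (merged scheme, abstract).**  Setting of the module docstring: `P, Q ⊆ E'` disjoint
threads, free remainder `E' ∖ (P ∪ Q)`; `Vp, hro` increasing, `kbo, N` decreasing with `N σ → ¬ P ⊆ σ ∧ ¬ Q ⊆ σ`; fibre system `SP ×ˢ SQ`, a thread frozen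
only if all sources start red on it; TRANSFER: every landing of every fibre satisfies `T`.  Then `#{σ ⊆ E' : Vp ∧ N ∧ hro ∧ kbo} ≤ #{ξ ⊆ E' : T ξ}`.
Memo gen 57 §2.  [cite: KozmaNitzan2024, Questions 8–9 (§5.5 p. 36) (context); Harris 1960] -/
theorem fibre_system_count (E' P Q : Finset ι) (hPE : P ⊆ E') (hQE : Q ⊆ E') (hPQ : Disjoint P Q) (ℓ m : ℕ) (hℓ : 1 ≤ ℓ) (hm : 1 ≤ m)
    (eP eQ : ℕ → ι)
    (heP : ∀ j, 1 ≤ j → j ≤ ℓ → eP j ∈ P) (hePinj : ∀ i j, 1 ≤ i → i ≤ ℓ → 1 ≤ j → j ≤ ℓ → eP i = eP j → i = j)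
    (hPe : ∀ x ∈ P, ∃ j, 1 ≤ j ∧ j ≤ ℓ ∧ eP j = x)
    (heQ : ∀ j, 1 ≤ j → j ≤ m → eQ j ∈ Q) (heQinj : ∀ i j, 1 ≤ i → i ≤ m → 1 ≤ j → j ≤ m → eQ i = eQ j → i = j)
    (hQe : ∀ x ∈ Q, ∃ j, 1 ≤ j ∧ j ≤ m ∧ eQ j = x)
    (Vp hro kbo N T : Finset ι → Prop)
    (V_mono : ∀ s t : Finset ι, s ⊆ t → Vp s → Vp t) (hro_mono : ∀ s t : Finset ι, s ⊆ t → hro s → hro t)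
    (kbo_anti : ∀ s t : Finset ι, s ⊆ t → kbo t → kbo s) (N_anti : ∀ s t : Finset ι, s ⊆ t → N t → N s)
    (hNPQ : ∀ σ, σ ⊆ E' → N σ → ¬ P ⊆ σ ∧ ¬ Q ⊆ σ)
    (SP SQ : Finset ℕ)
    (hSP : SP = {0} ∨ SP = Finset.Icc 1 (ℓ - 1)) (hSQ : SQ = {0} ∨ SQ = Finset.Icc 1 (m - 1))
    (covP : SP = Finset.Icc 1 (ℓ - 1) → ∀ σ, σ ⊆ E' → (Vp σ ∧ N σ ∧ hro σ ∧ kbo σ) → eP 1 ∈ σ)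
    (covQ : SQ = Finset.Icc 1 (m - 1) → ∀ σ, σ ⊆ E' → (Vp σ ∧ N σ ∧ hro σ ∧ kbo σ) → eQ 1 ∈ σ)
    (transfer : ∀ a c : ℕ, a ∈ SP → c ∈ SQ → a < ℓ → c < m → ∀ ξ ρ : Finset ι, ξ ⊆ E' → ρ ⊆ E' →
      (∀ j, 1 ≤ j → j ≤ a → eP j ∈ ξ ∧ eP j ∈ ρ) → (1 ≤ a → eP (a + 1) ∉ ξ ∧ eP (a + 1) ∉ ρ) →
      (∀ j, 1 ≤ j → j ≤ ℓ → (a = 0 ∨ a + 2 ≤ j) → (eP j ∈ ρ ↔ eP j ∉ ξ)) →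
      (∀ j, 1 ≤ j → j ≤ c → eQ j ∈ ξ ∧ eQ j ∈ ρ) → (1 ≤ c → eQ (c + 1) ∉ ξ ∧ eQ (c + 1) ∉ ρ) →
      (∀ j, 1 ≤ j → j ≤ m → (c = 0 ∨ c + 2 ≤ j) → (eQ j ∈ ρ ↔ eQ j ∉ ξ)) →
      (∀ x, x ∈ E' → x ∉ P → x ∉ Q → (x ∈ ρ ↔ x ∉ ξ)) →
      Vp ξ → hro ξ → kbo ρ → N ρ → T ξ) :
    ((E'.powerset).filter (fun σ => Vp σ ∧ N σ ∧ hro σ ∧ kbo σ)).card ≤ ((E'.powerset).filter (fun ξ => T ξ)).card := by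
  obtain ⟨preP, hpreP⟩ : ∃ f : ℕ → Finset ι, ∀ a x, x ∈ f a ↔ ∃ j, 1 ≤ j ∧ j ≤ a ∧ eP j = x :=
    ⟨fun a => (Finset.Icc 1 a).image eP, fun a x => by
      simp only [Finset.mem_image, Finset.mem_Icc]
      constructor
      · rintro ⟨j, ⟨h1, h2⟩, h3⟩; exact ⟨j, h1, h2, h3⟩
      · rintro ⟨j, h1, h2, h3⟩; exact ⟨j, ⟨h1, h2⟩, h3⟩⟩
  obtain ⟨preQ, hpreQ⟩ : ∃ f : ℕ → Finset ι, ∀ a x, x ∈ f a ↔ ∃ j, 1 ≤ j ∧ j ≤ a ∧ eQ j = x :=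
    ⟨fun a => (Finset.Icc 1 a).image eQ, fun a x => by
      simp only [Finset.mem_image, Finset.mem_Icc]
      constructor
      · rintro ⟨j, ⟨h1, h2⟩, h3⟩; exact ⟨j, h1, h2, h3⟩
      · rintro ⟨j, h1, h2, h3⟩; exact ⟨j, ⟨h1, h2⟩, h3⟩⟩
  obtain ⟨ΦP, hΦP⟩ : ∃ f : ℕ → Finset ι, f = fun a => if a = 0 then ∅ else preP (a + 1) := ⟨_, rfl⟩
  obtain ⟨ΦQ, hΦQ⟩ : ∃ f : ℕ → Finset ι, f = fun a => if a = 0 then ∅ else preQ (a + 1) := ⟨_, rfl⟩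
  have preP0 : preP 0 = ∅ := Finset.eq_empty_of_forall_notMem fun x hx => by
    obtain ⟨j, h1, h2, _⟩ := (hpreP 0 x).mp hx; omega
  have preQ0 : preQ 0 = ∅ := Finset.eq_empty_of_forall_notMem fun x hx => by
    obtain ⟨j, h1, h2, _⟩ := (hpreQ 0 x).mp hx; omega
  have preP_sub : ∀ a, a ≤ ℓ → preP a ⊆ P := fun a ha x hx => by
    obtain ⟨j, h1, h2, rfl⟩ := (hpreP a x).mp hx; exact heP j h1 (by omega)
  have preQ_sub : ∀ a, a ≤ m → preQ a ⊆ Q := fun a ha x hx => by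
    obtain ⟨j, h1, h2, rfl⟩ := (hpreQ a x).mp hx; exact heQ j h1 (by omega)
  have preP_mono : ∀ a, preP a ⊆ preP (a + 1) := fun a x hx => by
    obtain ⟨j, h1, h2, rfl⟩ := (hpreP a _).mp hx; exact (hpreP _ _).mpr ⟨j, h1, by omega, rfl⟩
  have preQ_mono : ∀ a, preQ a ⊆ preQ (a + 1) := fun a x hx => by
    obtain ⟨j, h1, h2, rfl⟩ := (hpreQ a _).mp hx; exact (hpreQ _ _).mpr ⟨j, h1, by omega, rfl⟩
  have ΦP_cases : ∀ a, (a = 0 ∧ ΦP a = ∅) ∨ (1 ≤ a ∧ ΦP a = preP (a + 1)) := by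
    intro a; rw [hΦP]; by_cases h : a = 0
    · exact Or.inl ⟨h, by simp [h]⟩
    · exact Or.inr ⟨Nat.one_le_iff_ne_zero.mpr h, by simp [h]⟩
  have ΦQ_cases : ∀ c, (c = 0 ∧ ΦQ c = ∅) ∨ (1 ≤ c ∧ ΦQ c = preQ (c + 1)) := by
    intro c; rw [hΦQ]; by_cases h : c = 0
    · exact Or.inl ⟨h, by simp [h]⟩
    · exact Or.inr ⟨Nat.one_le_iff_ne_zero.mpr h, by simp [h]⟩
  have ΦP_sub : ∀ a, a < ℓ → preP a ⊆ ΦP a ∧ ΦP a ⊆ P := by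
    intro a ha
    rcases ΦP_cases a with ⟨h0, hF⟩ | ⟨_, hF⟩
    · rw [hF, h0, preP0]; exact ⟨le_refl _, Finset.empty_subset _⟩
    · rw [hF]; exact ⟨preP_mono a, preP_sub (a + 1) (by omega)⟩
  have ΦQ_sub : ∀ c, c < m → preQ c ⊆ ΦQ c ∧ ΦQ c ⊆ Q := by
    intro c hc
    rcases ΦQ_cases c with ⟨h0, hF⟩ | ⟨_, hF⟩
    · rw [hF, h0, preQ0]; exact ⟨le_refl _, Finset.empty_subset _⟩
    · rw [hF]; exact ⟨preQ_mono c, preQ_sub (c + 1) (by omega)⟩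
  have ΦP_pos : ∀ a, 1 ≤ a → ΦP a = preP (a + 1) := by
    intro a ha; rcases ΦP_cases a with ⟨h0, _⟩ | ⟨_, hF⟩
    · omega
    · exact hF
  have ΦQ_pos : ∀ c, 1 ≤ c → ΦQ c = preQ (c + 1) := by
    intro c hc; rcases ΦQ_cases c with ⟨h0, _⟩ | ⟨_, hF⟩
    · omega
    · exact hF
  have ΦP_zero : ∀ ξ : Finset ι, ξ ∩ ΦP 0 = preP 0 := by
    intro ξ; rcases ΦP_cases 0 with ⟨_, hF⟩ | ⟨h1, _⟩
    · rw [hF, preP0, Finset.inter_empty]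
    · omega
  have ΦQ_zero : ∀ ξ : Finset ι, ξ ∩ ΦQ 0 = preQ 0 := by
    intro ξ; rcases ΦQ_cases 0 with ⟨_, hF⟩ | ⟨h1, _⟩
    · rw [hF, preQ0, Finset.inter_empty]
    · omega
  obtain ⟨src, hsrc⟩ : ∃ f : Finset ι → Prop, f = fun ξ => Vp ξ ∧ N ξ ∧ hro ξ ∧ kbo ξ := ⟨_, rfl⟩
  obtain ⟨fib, hfibd⟩ : ∃ f : ℕ × ℕ → Finset ι → Prop, f = fun j ξ => ξ ∩ ΦP j.1 = preP j.1 ∧ ξ ∩ ΦQ j.2 = preQ j.2 := ⟨_, rfl⟩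
  obtain ⟨ρ, hρ⟩ : ∃ f : ℕ × ℕ → Finset ι → Finset ι,
      f = fun j ξ => (preP j.1 ∪ preQ j.2) ∪ ((E' \ (ΦP j.1 ∪ ΦQ j.2)) \ ξ) := ⟨_, rfl⟩
  obtain ⟨land, hland⟩ : ∃ f : ℕ × ℕ → Finset ι → Prop, f = fun j ξ => Vp ξ ∧ hro ξ ∧ kbo (ρ j ξ) ∧ N (ρ j ξ) := ⟨_, rfl⟩
  -- ## the per-fibre flow
  have fib_iff : ∀ a c, a < ℓ → c < m → ∀ ξ : Finset ι, fib (a, c) ξ ↔ ξ ∩ (ΦP a ∪ ΦQ c) = preP a ∪ preQ c := by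
    intro a c ha hc ξ
    rw [hfibd]
    exact prefix_fibre_inter_iff P Q (ΦP a) (preP a) (ΦQ c) (preQ c) ξ hPQ (ΦP_sub a ha).1 (ΦP_sub a ha).2 (ΦQ_sub c hc).1 (ΦQ_sub c hc).2
  have flow : ∀ a c, a < ℓ → c < m →
      ((E'.powerset).filter (fun ξ => fib (a, c) ξ ∧ src ξ)).card ≤ ((E'.powerset).filter (fun ξ => fib (a, c) ξ ∧ land (a, c) ξ)).card := by
    intro a c ha hc
    have hπΦ : preP a ∪ preQ c ⊆ ΦP a ∪ ΦQ c := Finset.union_subset_union (ΦP_sub a ha).1 (ΦQ_sub c hc).1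
    have hΦE : ΦP a ∪ ΦQ c ⊆ E' := Finset.union_subset ((ΦP_sub a ha).2.trans hPE) ((ΦQ_sub c hc).2.trans hQE)
    have k₁ := frozen_fibre_flow E' (ΦP a ∪ ΦQ c) (preP a ∪ preQ c) hπΦ hΦE Vp hro kbo N V_mono hro_mono kbo_anti N_anti
    have c1 : (E'.powerset).filter (fun ξ => fib (a, c) ξ ∧ src ξ) =
        (E'.powerset).filter (fun ξ => ξ ∩ (ΦP a ∪ ΦQ c) = preP a ∪ preQ c ∧ (Vp ξ ∧ N ξ ∧ hro ξ ∧ kbo ξ)) :=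
      Finset.filter_congr fun ξ _ => by rw [fib_iff a c ha hc ξ, hsrc]
    have c2 : (E'.powerset).filter (fun ξ => fib (a, c) ξ ∧ land (a, c) ξ) =
        (E'.powerset).filter (fun ξ => ξ ∩ (ΦP a ∪ ΦQ c) = preP a ∪ preQ c ∧
          (Vp ξ ∧ hro ξ ∧ kbo (preP a ∪ preQ c ∪ ((E' \ (ΦP a ∪ ΦQ c)) \ ξ)) ∧ N (preP a ∪ preQ c ∪ ((E' \ (ΦP a ∪ ΦQ c)) \ ξ)))) :=
      Finset.filter_congr fun ξ _ => by rw [fib_iff a c ha hc ξ, hland, hρ]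
    rw [c1, c2]
    exact k₁
  -- ## edge-by-edge description of a fibre point and its partner
  have partner : ∀ a c, a < ℓ → c < m → ∀ ξ : Finset ι, fib (a, c) ξ →
      ρ (a, c) ξ ⊆ E' ∧
      (∀ j, 1 ≤ j → j ≤ a → eP j ∈ ξ ∧ eP j ∈ ρ (a, c) ξ) ∧ (1 ≤ a → eP (a + 1) ∉ ξ ∧ eP (a + 1) ∉ ρ (a, c) ξ) ∧
      (∀ j, 1 ≤ j → j ≤ ℓ → (a = 0 ∨ a + 2 ≤ j) → (eP j ∈ ρ (a, c) ξ ↔ eP j ∉ ξ)) ∧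
      (∀ j, 1 ≤ j → j ≤ c → eQ j ∈ ξ ∧ eQ j ∈ ρ (a, c) ξ) ∧ (1 ≤ c → eQ (c + 1) ∉ ξ ∧ eQ (c + 1) ∉ ρ (a, c) ξ) ∧
      (∀ j, 1 ≤ j → j ≤ m → (c = 0 ∨ c + 2 ≤ j) → (eQ j ∈ ρ (a, c) ξ ↔ eQ j ∉ ξ)) ∧
      (∀ x, x ∈ E' → x ∉ P → x ∉ Q → (x ∈ ρ (a, c) ξ ↔ x ∉ ξ)) := by
    intro a c ha hc ξ hfib
    rw [hfibd] at hfib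
    obtain ⟨hfP, hfQ⟩ := hfib
    have hρE : ρ (a, c) ξ ⊆ E' := by
      rw [hρ]
      exact Finset.union_subset (Finset.union_subset ((preP_sub a (le_of_lt ha)).trans hPE) ((preQ_sub c (le_of_lt hc)).trans hQE))
        (Finset.sdiff_subset.trans Finset.sdiff_subset)
    have hP' := prefix_partner_mem eP ℓ P E' (ΦP a ∪ ΦQ c) (preP a ∪ preQ c) (ΦQ c) (preQ c) hePinj heP hPE
      (Finset.disjoint_of_subset_left (ΦQ_sub c hc).2 hPQ.symm) (ΦQ_sub c hc).1 preP hpreP a ha (ΦP a) (ΦP_cases a) rfl rfl ξ hfP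
    have hQ' := prefix_partner_mem eQ m Q E' (ΦP a ∪ ΦQ c) (preP a ∪ preQ c) (ΦP a) (preP a) heQinj heQ hQE
      (Finset.disjoint_of_subset_left (ΦP_sub a ha).2 hPQ) (ΦP_sub a ha).1 preQ hpreQ c hc (ΦQ c) (ΦQ_cases c)
      (Finset.union_comm _ _) (Finset.union_comm _ _) ξ hfQ
    have hρ' : ρ (a, c) ξ = preP a ∪ preQ c ∪ ((E' \ (ΦP a ∪ ΦQ c)) \ ξ) := by rw [hρ]
    have hrest : ∀ x, x ∈ E' → x ∉ P → x ∉ Q → (x ∈ ρ (a, c) ξ ↔ x ∉ ξ) := by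
      intro x hx hxP hxQ
      have hxΦ : x ∉ ΦP a ∪ ΦQ c := fun hm => by
        rcases Finset.mem_union.mp hm with h | h
        · exact hxP ((ΦP_sub a ha).2 h)
        · exact hxQ ((ΦQ_sub c hc).2 h)
      have hxπ : x ∉ preP a ∪ preQ c := fun hm => by
        rcases Finset.mem_union.mp hm with h | h
        · exact hxP (preP_sub a (le_of_lt ha) h)
        · exact hxQ (preQ_sub c (le_of_lt hc) h)
      rw [hρ', Finset.mem_union, Finset.mem_sdiff, Finset.mem_sdiff]
      constructor
      · rintro (h | ⟨_, h⟩)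
        · exact absurd h hxπ
        · exact h
      · intro h; exact Or.inr ⟨⟨hx, hxΦ⟩, h⟩
    rw [hρ']
    exact ⟨hρ' ▸ hρE, hP'.1, hP'.2.1, hP'.2.2.1, hQ'.1, hQ'.2.1, hQ'.2.2.1, hρ' ▸ hrest⟩
  have memS : ∀ (S : Finset ℕ) (n : ℕ), 1 ≤ n → (S = {0} ∨ S = Finset.Icc 1 (n - 1)) → ∀ a ∈ S, a < n := by
    intro S n hn hS a ha
    rcases hS with hS | hS
    · rw [hS, Finset.mem_singleton] at ha; omega
    · rw [hS, Finset.mem_Icc] at ha; omega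
  have memS2 : ∀ (S : Finset ℕ) (n : ℕ), (S = {0} ∨ S = Finset.Icc 1 (n - 1)) → ∀ a ∈ S, ∀ a' ∈ S, a ≠ a' → 1 ≤ a ∧ 1 ≤ a' := by
    intro S n hS a ha a' ha' hne
    rcases hS with hS | hS
    · rw [hS, Finset.mem_singleton] at ha ha'; omega
    · rw [hS, Finset.mem_Icc] at ha ha'; exact ⟨ha.1, ha'.1⟩
  -- ## disjointness and cover of the fibre system
  have disj : ∀ j ∈ SP ×ˢ SQ, ∀ j' ∈ SP ×ˢ SQ, j ≠ j' → ∀ ξ, fib j ξ → fib j' ξ → False := by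
    intro j hj j' hj' hne ξ h1 h2
    obtain ⟨a, c⟩ := j
    obtain ⟨a', c'⟩ := j'
    rw [Finset.mem_product] at hj hj'
    simp only at hj hj'
    rw [hfibd] at h1 h2
    simp only at h1 h2
    have ha := memS SP ℓ hℓ hSP a hj.1
    have ha' := memS SP ℓ hℓ hSP a' hj'.1
    have hc := memS SQ m hm hSQ c hj.2
    have hc' := memS SQ m hm hSQ c' hj'.2
    by_cases haa : a = a'
    · have hcc : c ≠ c' := by intro hcc; exact hne (by rw [haa, hcc])
      obtain ⟨h1c, h1c'⟩ := memS2 SQ m hSQ c hj.2 c' hj'.2 hcc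
      have e1 := h1.2; have e2 := h2.2
      rw [ΦQ_pos c h1c] at e1; rw [ΦQ_pos c' h1c'] at e2
      exact prefix_fibre_disjoint eQ m heQinj preQ hpreQ c c' h1c h1c' hc hc' hcc ξ e1 e2
    · obtain ⟨h1a, h1a'⟩ := memS2 SP ℓ hSP a hj.1 a' hj'.1 haa
      have e1 := h1.1; have e2 := h2.1
      rw [ΦP_pos a h1a] at e1; rw [ΦP_pos a' h1a'] at e2
      exact prefix_fibre_disjoint eP ℓ hePinj preP hpreP a a' h1a h1a' ha ha' haa ξ e1 e2
  have cover : ∀ σ : Finset ι, σ ⊆ E' → src σ → ∃ j ∈ SP ×ˢ SQ, fib j σ := by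
    intro σ hσE hs
    rw [hsrc] at hs
    have hNσ := hNPQ σ hσE hs.2.1
    have exa : ∃ a ∈ SP, σ ∩ ΦP a = preP a := by
      rcases hSP with hS | hS
      · exact ⟨0, by rw [hS]; exact Finset.mem_singleton_self 0, ΦP_zero σ⟩
      · obtain ⟨a, ha1, haℓ, hfa⟩ := prefix_fibre_cover eP ℓ P hPe preP hpreP σ (covP hS σ hσE hs) hNσ.1
        exact ⟨a, by rw [hS, Finset.mem_Icc]; omega, by rw [ΦP_pos a ha1]; exact hfa⟩
    have exc : ∃ c ∈ SQ, σ ∩ ΦQ c = preQ c := by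
      rcases hSQ with hS | hS
      · exact ⟨0, by rw [hS]; exact Finset.mem_singleton_self 0, ΦQ_zero σ⟩
      · obtain ⟨c, hc1, hcm, hfc⟩ := prefix_fibre_cover eQ m Q hQe preQ hpreQ σ (covQ hS σ hσE hs) hNσ.2
        exact ⟨c, by rw [hS, Finset.mem_Icc]; omega, by rw [ΦQ_pos c hc1]; exact hfc⟩
    obtain ⟨a, haS, hfa⟩ := exa
    obtain ⟨c, hcS, hfc⟩ := exc
    exact ⟨(a, c), Finset.mem_product.mpr ⟨haS, hcS⟩, by rw [hfibd]; exact ⟨hfa, hfc⟩⟩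
  -- ## sources ≤ landings (a set), landings are targets
  set Λ : Finset (Finset ι) := (SP ×ˢ SQ).biUnion (fun j => (E'.powerset).filter (fun ξ => fib j ξ ∧ land j ξ)) with hΛ
  have hsub : (E'.powerset).filter (fun ξ => src ξ) ⊆ (SP ×ˢ SQ).biUnion (fun j => (E'.powerset).filter (fun ξ => fib j ξ ∧ src ξ)) := by
    intro ξ hξ
    rw [Finset.mem_filter, Finset.mem_powerset] at hξ
    obtain ⟨j, hj, hfib⟩ := cover ξ hξ.1 hξ.2
    exact Finset.mem_biUnion.mpr ⟨j, hj, Finset.mem_filter.mpr ⟨Finset.mem_powerset.mpr hξ.1, hfib, hξ.2⟩⟩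
  have hdisj : (↑(SP ×ˢ SQ) : Set (ℕ × ℕ)).PairwiseDisjoint (fun j => (E'.powerset).filter (fun ξ => fib j ξ ∧ land j ξ)) := by
    intro j hj j' hj' hjj'
    rw [Function.onFun, Finset.disjoint_left]
    intro ξ h1 h2
    rw [Finset.mem_filter] at h1 h2
    exact disj j hj j' hj' hjj' ξ h1.2.1 h2.2.1
  have b₁ : ((E'.powerset).filter (fun ξ => src ξ)).card ≤ Λ.card :=
    calc ((E'.powerset).filter (fun ξ => src ξ)).card
        ≤ ((SP ×ˢ SQ).biUnion (fun j => (E'.powerset).filter (fun ξ => fib j ξ ∧ src ξ))).card := Finset.card_le_card hsub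
      _ ≤ ∑ j ∈ SP ×ˢ SQ, ((E'.powerset).filter (fun ξ => fib j ξ ∧ src ξ)).card := Finset.card_biUnion_le
      _ ≤ ∑ j ∈ SP ×ˢ SQ, ((E'.powerset).filter (fun ξ => fib j ξ ∧ land j ξ)).card :=
          Finset.sum_le_sum fun j hj => flow j.1 j.2 (memS SP ℓ hℓ hSP j.1 (Finset.mem_product.mp hj).1)
            (memS SQ m hm hSQ j.2 (Finset.mem_product.mp hj).2)
      _ = Λ.card := (Finset.card_biUnion hdisj).symm
  have hT : Λ ⊆ (E'.powerset).filter (fun ξ => T ξ) := by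
    intro ξ hξ
    obtain ⟨j, hj, hmem⟩ := Finset.mem_biUnion.mp hξ
    rw [Finset.mem_filter, Finset.mem_powerset] at hmem
    obtain ⟨a, c⟩ := j
    have haS := (Finset.mem_product.mp hj).1
    have hcS := (Finset.mem_product.mp hj).2
    have ha := memS SP ℓ hℓ hSP a haS
    have hc := memS SQ m hm hSQ c hcS
    obtain ⟨hρE, p1, p2, p3, q1, q2, q3, rest⟩ := partner a c ha hc ξ hmem.2.1
    have hl := hmem.2.2
    rw [hland] at hl
    obtain ⟨hv, hh, hk, hn⟩ := hl
    exact Finset.mem_filter.mpr ⟨Finset.mem_powerset.mpr hmem.1,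
      transfer a c haS hcS ha hc ξ (ρ (a, c) ξ) hmem.1 hρE p1 p2 p3 q1 q2 q3 rest hv hh hk hn⟩
  have e1 : (E'.powerset).filter (fun σ => Vp σ ∧ N σ ∧ hro σ ∧ kbo σ) = (E'.powerset).filter (fun ξ => src ξ) :=
    Finset.filter_congr fun ξ _ => by rw [hsrc]
  rw [e1]
  exact b₁.trans (Finset.card_le_card hT)

end Coefficientwise

end Summit.CriticalPhenomena.PercolationContinuityZ3.Theorems
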